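import Summits.Ventures.HodgeRepro2.T5RecordSatakeInert
import Summits.Ventures.HodgeRepro2.T5QuadraticInertBridge
import Summits.Ventures.HodgeRepro2.T5FinitePlaceSplitIff
import Summits.Ventures.HodgeRepro2.T5BadPlacesFinite

/-!
# The record's spherical Hecke algebra is commutative at EVERY unramified good place

Tier-5 support N3 / §G-N4.2 (seat p3, gen 76, cont.). Files 231 / 233 prove the commutativity of the record's
spherical Hecke algebra `H(U(1 ⊗ H), K_v)` at a split place (file 231, `heckeAlgebra_mul_comm_record_split`, given
the conjugate place `w' = c • w`) and at a place that stays prime (file 233,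
`heckeAlgebra_mul_comm_record_of_staysPrime`). This file joins the two through seat p8's split/non-split dichotomy
of a finite place of `K⁺` in the CM field `K` (`T5FinitePlaceSplitIff`: `v` is non-split iff it has one prime
above it iff `θ` is not a `v`-adic square) and the bridge `unique prime + e(w/v) = 1 ⇒ v 𝓞_K = w` (seat p8's
`T5QuadraticInertBridge.map_eq_asIdeal_of_unique_of_ramificationIdx'_eq_one`):

* **`heckeAlgebra_mul_comm_record_of_ramificationIdx'_eq_one`** — for the datum's `3 × 3` hermitian invertible
  Gram matrix `H` over `K`, at every place `w ∣ v` with `e(w/v) = 1` (`v` unramified in `K`) and `w ∉ badSet H`,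
  `H(U(1 ⊗ H), K_v)` is commutative: the hypothesis set is now GLOBAL and finite-exceptional — the ramified places
  and the bad places of `H` (finitely many, file 222) are the only exceptions;
* `nonempty_algEquiv_polynomial_record_of_ramificationIdx'_eq_one` — and at such a place that is non-split (`θ` not
  a `v`-adic square) it is `k[X]`;
* **`exists_finite_forall_heckeAlgebra_mul_comm_record`** — there is a FINITE set `Sv` of places of `K⁺` such that
  `H(U(1 ⊗ H), K_v)` is commutative at every `v ∉ Sv` and every `w ∣ v`, with no per-place hypothesis at all (file
  223's census `exists_finite_census_and_good`: outside `Sv` the place stays prime or has two places above it, and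
  is good for `H`), and `exists_finite_forall_nonempty_algEquiv_polynomial_record` — `k[X]` at every non-split
  place outside `Sv`;
* `eq_of_liesOver_of_ncard_primesOver_eq_one`, `map_eq_of_ramificationIdx'_eq_one_of_not_isSquare`
  (non-split + unramified ⇒ stays prime), `exists_conj_place_of_isSquare` (the conjugate place `c • w` as a
  `HeightOneSpectrum`, lying over `v` and different from `w` at a split place) — the glue.

§8(d): uses an L-value-free non-vanishing device: NO.
-/

open Matrix NumberField NumberField.IsCMField IsDedekindDomain IsDedekindDomain.HeightOneSpectrum Module
open scoped TensorProduct Pointwise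
open Summit.Ventures.HodgeRepro2.T5UnitaryGroupForm Summit.Ventures.HodgeRepro2.T5UnitaryHeckeAdjoint
  Summit.Ventures.HodgeRepro2.T5HeckePermutationModule Summit.Ventures.HodgeRepro2.T5StarOfInvolution
  Summit.Ventures.HodgeRepro2.T5FinitePlaceCM Summit.Ventures.HodgeRepro2.T5FinitePlaceNormIndex
  Summit.Ventures.HodgeRepro2.T5NonSplitPlaceUnitaryGroup Summit.Ventures.HodgeRepro2.T5RecordHyperspecial
  Summit.Ventures.HodgeRepro2.T5GlobalLatticeAlmostAll Summit.Ventures.HodgeRepro2.T5FinitePlaceSplitClassification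
  Summit.Ventures.HodgeRepro2.T5RecordSatake Summit.Ventures.HodgeRepro2.T5RecordSatakeInert
  Summit.Ventures.HodgeRepro2.T5QuadraticInertBridge Summit.Ventures.HodgeRepro2.T5FinitePlaceSplitIff
  Summit.Ventures.HodgeRepro2.T5FinitePlaceCMDecomp Summit.Ventures.HodgeRepro2.T5BadPlacesFinite

namespace Summit.Ventures.HodgeRepro2.T5RecordSatakeUnramified

section Record

variable (K : Type*) [Field K] [NumberField K] [IsCMField K]
variable (v : HeightOneSpectrum (𝓞 (maximalRealSubfield K))) (w : HeightOneSpectrum (𝓞 K))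
  [w.asIdeal.LiesOver v.asIdeal]
variable {θ : maximalRealSubfield K} {y : K}
  (hθ : algebraMap (maximalRealSubfield K) K θ = y ^ 2) (hy : complexConj K y ≠ y)
variable {r : ℕ} (l : Fin r → 𝓞 K)

omit [NumberField K] [IsCMField K] in
/-- **A unique prime above `v`**: if `v` has exactly one prime of `𝓞_K` above it, every place `w'` over `v` is `w`. -/
theorem eq_of_liesOver_of_ncard_primesOver_eq_one (h1 : (v.asIdeal.primesOver (𝓞 K)).ncard = 1)
    (w' : HeightOneSpectrum (𝓞 K)) (hw' : w'.asIdeal.LiesOver v.asIdeal) : w' = w := by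
  obtain ⟨a, ha⟩ := Set.ncard_eq_one.mp h1
  have hw : w.asIdeal ∈ v.asIdeal.primesOver (𝓞 K) := ⟨w.isPrime, inferInstance⟩
  have hw'' : w'.asIdeal ∈ v.asIdeal.primesOver (𝓞 K) := ⟨w'.isPrime, hw'⟩
  rw [ha, Set.mem_singleton_iff] at hw hw''
  exact HeightOneSpectrum.ext (hw''.trans hw.symm)

include hθ hy in
/-- **Non-split and unramified ⇒ stays prime**: if `θ` is not a `v`-adic square (`v` has one prime above it, seat
p8's `ncard_primesOver_eq_one_iff_not_isSquare`) and `e(w/v) = 1`, then `v 𝓞_K = w` (seat p8's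
`map_eq_asIdeal_of_unique_of_ramificationIdx'_eq_one`). -/
theorem map_eq_of_ramificationIdx'_eq_one_of_not_isSquare (he : v.asIdeal.ramificationIdx' w.asIdeal = 1)
    (hsq : ¬ IsSquare (algebraMap (maximalRealSubfield K) (v.adicCompletion (maximalRealSubfield K)) θ)) :
    Ideal.map (algebraMap (𝓞 (maximalRealSubfield K)) (𝓞 K)) v.asIdeal = w.asIdeal :=
  map_eq_asIdeal_of_unique_of_ramificationIdx'_eq_one v w
    (fun w' hw' => eq_of_liesOver_of_ncard_primesOver_eq_one K v w
      ((ncard_primesOver_eq_one_iff_not_isSquare K v w hθ hy).mpr hsq) w' hw') he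

include hθ hy in
/-- **The conjugate place at a split place**: if `θ` is a `v`-adic square, `c • w` is a place of `K` over `v`
different from `w` (seat p8's `complexConj_smul_ne_of_isSquare`; primality, non-triviality and lying over `v` of the
conjugate ideal are Mathlib's `Ideal.IsPrime.smul`, `inv_smul_smul` + `Ideal.smul_bot`, `Ideal.LiesOver.smul`). -/
theorem exists_conj_place_of_isSquare
    (hsq : IsSquare (algebraMap (maximalRealSubfield K) (v.adicCompletion (maximalRealSubfield K)) θ)) :
    ∃ w' : HeightOneSpectrum (𝓞 K), w'.asIdeal.LiesOver v.asIdeal ∧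
      complexConj K • w.asIdeal = w'.asIdeal ∧ w ≠ w' := by
  refine ⟨⟨complexConj K • w.asIdeal, Ideal.IsPrime.smul _, ?_⟩, inferInstance, rfl, ?_⟩
  · intro h
    apply w.ne_bot
    rw [← inv_smul_smul (complexConj K) w.asIdeal, h, Ideal.smul_bot]
  · intro h
    exact complexConj_smul_ne_of_isSquare K hθ hy v w hsq (congrArg HeightOneSpectrum.asIdeal h).symm

include hθ hy in
/-- **THE RECORD'S SPHERICAL HECKE ALGEBRA IS COMMUTATIVE AT EVERY UNRAMIFIED GOOD PLACE**: for the datum's `3 × 3`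
hermitian invertible Gram matrix `H` over `K` and a place `w ∣ v` of `K` with `e(w/v) = 1` and `w ∉ badSet H`,
`H(U(1 ⊗ H), K_v)` is commutative — split places by file 231's `heckeAlgebra_mul_comm_record_split` on the conjugate
place `c • w`, non-split places by file 233's `heckeAlgebra_mul_comm_record_of_staysPrime` (they stay prime). -/
theorem heckeAlgebra_mul_comm_record_of_ramificationIdx'_eq_one (k : Type*) [Field k]
    (hl : Submodule.span (𝓞 (maximalRealSubfield K)) (Set.range l) = ⊤)
    (he : v.asIdeal.ramificationIdx' w.asIdeal = 1)
    {H : Matrix (Fin 3) (Fin 3) K} (hH : H.IsHermitian) (hdet : IsUnit H.det) (hgood : w ∉ badSet H)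
    (T S : (letI := tensorStarRing K v; ↥(heckeAlgebra k (recordHyperspecial K v l H)))) :
    T * S = S * T := by
  by_cases hsq : IsSquare (algebraMap (maximalRealSubfield K) (v.adicCompletion (maximalRealSubfield K)) θ)
  · exact (exists_conj_place_of_isSquare K v w hθ hy hsq).elim fun w' h =>
      haveI := h.1
      heckeAlgebra_mul_comm_record_split K v w w' h.2.1 hθ hy h.2.2 hsq l k hl hH hdet hgood T S
  · exact heckeAlgebra_mul_comm_record_of_staysPrime K v w hθ hy
      (map_eq_of_ramificationIdx'_eq_one_of_not_isSquare K v w hθ hy he hsq) l k hl hH hdet hgood T S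

include hθ hy in
/-- **`k[X]` at every unramified non-split good place**: file 233's `nonempty_algEquiv_polynomial_record_of_staysPrime`
under the global hypotheses `e(w/v) = 1` and `θ` not a `v`-adic square. -/
theorem nonempty_algEquiv_polynomial_record_of_ramificationIdx'_eq_one (k : Type*) [Field k]
    (hl : Submodule.span (𝓞 (maximalRealSubfield K)) (Set.range l) = ⊤)
    (he : v.asIdeal.ramificationIdx' w.asIdeal = 1)
    (hsq : ¬ IsSquare (algebraMap (maximalRealSubfield K) (v.adicCompletion (maximalRealSubfield K)) θ))
    {H : Matrix (Fin 3) (Fin 3) K} (hH : H.IsHermitian) (hdet : IsUnit H.det) (hgood : w ∉ badSet H) :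
    Nonempty (Polynomial k ≃ₐ[k]
      (letI := tensorStarRing K v; ↥(heckeAlgebra k (recordHyperspecial K v l H)))) :=
  nonempty_algEquiv_polynomial_record_of_staysPrime K v w hθ hy
    (map_eq_of_ramificationIdx'_eq_one_of_not_isSquare K v w hθ hy he hsq) l k hl hH hdet hgood

omit [IsCMField K] in
/-- If `v 𝓞_K = w₀` for some place `w₀`, then `v 𝓞_K = w` for every place `w` over `v`: `w₀ = v 𝓞_K ≤ w` and `w₀` is
maximal. -/
theorem map_eq_of_exists_map_eq (hex : ∃ w₀ : HeightOneSpectrum (𝓞 K),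
      Ideal.map (algebraMap (𝓞 (maximalRealSubfield K)) (𝓞 K)) v.asIdeal = w₀.asIdeal) :
    Ideal.map (algebraMap (𝓞 (maximalRealSubfield K)) (𝓞 K)) v.asIdeal = w.asIdeal := by
  obtain ⟨w₀, hw₀⟩ := hex
  have hle : w₀.asIdeal ≤ w.asIdeal := by
    rw [← hw₀, Ideal.map_le_iff_le_comap]
    exact le_of_eq Ideal.LiesOver.over
  rw [hw₀]
  exact w₀.isMaximal.eq_of_le w.isPrime.ne_top hle

include hθ hy in
/-- Two distinct places of `K` over `v` make `θ` a `v`-adic square (seat p8's `ncard_primesOver_eq_one_or_two` and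
`isSquare_of_ncard_primesOver_eq_two`). -/
theorem isSquare_of_ne_of_liesOver (w₁ w₂ : HeightOneSpectrum (𝓞 K)) (hne : w₁ ≠ w₂)
    (h₁ : w₁.asIdeal.LiesOver v.asIdeal) (h₂ : w₂.asIdeal.LiesOver v.asIdeal) :
    IsSquare (algebraMap (maximalRealSubfield K) (v.adicCompletion (maximalRealSubfield K)) θ) := by
  haveI := h₁
  refine isSquare_of_ncard_primesOver_eq_two K v w₁ hθ hy ?_
  rcases ncard_primesOver_eq_one_or_two K v with h | h
  · exact absurd (eq_of_liesOver_of_ncard_primesOver_eq_one K v w₁ h w₂ h₂).symm hne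
  · exact h

include hθ hy in
/-- **THE CENSUS FOR THE RECORD'S PAIR**: for every matrix `H` over `K` there is a finite set `Sv` of places of `K⁺`
such that every place `w` of `K` over a `v ∉ Sv` is good for `H` and `v` either stays prime (`v 𝓞_K = w`) or is
split (`θ` a `v`-adic square) — file 223's `exists_finite_census_and_good` read through `map_eq_of_exists_map_eq`
and `isSquare_of_ne_of_liesOver`. -/
theorem exists_finite_forall_notMem_badSet_and_map_eq_or_isSquare {ι : Type*} [Fintype ι] [DecidableEq ι]
    (H : Matrix ι ι K) :
    ∃ Sv : Set (HeightOneSpectrum (𝓞 (maximalRealSubfield K))), Sv.Finite ∧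
      ∀ v ∉ Sv, ∀ (w : HeightOneSpectrum (𝓞 K)) [w.asIdeal.LiesOver v.asIdeal],
        w ∉ badSet H ∧ (Ideal.map (algebraMap (𝓞 (maximalRealSubfield K)) (𝓞 K)) v.asIdeal = w.asIdeal ∨
          IsSquare (algebraMap (maximalRealSubfield K) (v.adicCompletion (maximalRealSubfield K)) θ)) := by
  obtain ⟨d, Sv, hSv, hcen⟩ := exists_finite_census_and_good (E := K) H H
  refine ⟨Sv, hSv, fun v hv w hw => ⟨((hcen v hv).2.2 w hw).1, ?_⟩⟩
  by_cases hd : IsSquare (Ideal.Quotient.mk v.asIdeal d)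
  · obtain ⟨w₁, w₂, hne, h₁, h₂⟩ := (hcen v hv).1.2.2 hd
    exact Or.inr (isSquare_of_ne_of_liesOver K v hθ hy w₁ w₂ hne h₁ h₂)
  · exact Or.inl (map_eq_of_exists_map_eq K v w ((hcen v hv).1.2.1.mpr hd))

include hθ hy in
/-- **THE RECORD'S SPHERICAL HECKE ALGEBRA IS COMMUTATIVE AT ALL BUT FINITELY MANY PLACES, WITH NO PER-PLACE
HYPOTHESIS**: for the datum's `3 × 3` hermitian invertible Gram matrix `H` over `K` there is a finite set `Sv` of
places of `K⁺` such that at every `v ∉ Sv` and every place `w` of `K` over `v`, `H(U(1 ⊗ H), K_v)` is commutative —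
the census `exists_finite_forall_notMem_badSet_and_map_eq_or_isSquare`, then file 233's
`heckeAlgebra_mul_comm_record_of_staysPrime` (stays prime) or file 231's `heckeAlgebra_mul_comm_record_split` on
the conjugate place `c • w` (split). -/
theorem exists_finite_forall_heckeAlgebra_mul_comm_record (k : Type*) [Field k]
    (hl : Submodule.span (𝓞 (maximalRealSubfield K)) (Set.range l) = ⊤)
    {H : Matrix (Fin 3) (Fin 3) K} (hH : H.IsHermitian) (hdet : IsUnit H.det) :
    ∃ Sv : Set (HeightOneSpectrum (𝓞 (maximalRealSubfield K))), Sv.Finite ∧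
      ∀ v ∉ Sv, ∀ (w : HeightOneSpectrum (𝓞 K)) [w.asIdeal.LiesOver v.asIdeal],
        ∀ T S : (letI := tensorStarRing K v; ↥(heckeAlgebra k (recordHyperspecial K v l H))), T * S = S * T :=
  (exists_finite_forall_notMem_badSet_and_map_eq_or_isSquare K hθ hy H).elim fun Sv h =>
    ⟨Sv, h.1, fun v hv w _ => (h.2 v hv w).2.elim
      (fun hmap => heckeAlgebra_mul_comm_record_of_staysPrime K v w hθ hy hmap l k hl hH hdet (h.2 v hv w).1)
      (fun hsq => (exists_conj_place_of_isSquare K v w hθ hy hsq).elim fun w' h' =>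
        haveI := h'.1
        heckeAlgebra_mul_comm_record_split K v w w' h'.2.1 hθ hy h'.2.2 hsq l k hl hH hdet (h.2 v hv w).1)⟩

include hθ hy in
/-- **`k[X]` AT ALL BUT FINITELY MANY NON-SPLIT PLACES**: outside the finite set `Sv` of the census, at every
non-split place (`θ` not a `v`-adic square) the record's spherical Hecke algebra is `k[X]` — the place stays prime
there, and file 233's `nonempty_algEquiv_polynomial_record_of_staysPrime` applies. -/
theorem exists_finite_forall_nonempty_algEquiv_polynomial_record (k : Type*) [Field k]
    (hl : Submodule.span (𝓞 (maximalRealSubfield K)) (Set.range l) = ⊤)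
    {H : Matrix (Fin 3) (Fin 3) K} (hH : H.IsHermitian) (hdet : IsUnit H.det) :
    ∃ Sv : Set (HeightOneSpectrum (𝓞 (maximalRealSubfield K))), Sv.Finite ∧
      ∀ v ∉ Sv, ∀ (w : HeightOneSpectrum (𝓞 K)) [w.asIdeal.LiesOver v.asIdeal],
        ¬ IsSquare (algebraMap (maximalRealSubfield K) (v.adicCompletion (maximalRealSubfield K)) θ) →
        Nonempty (Polynomial k ≃ₐ[k]
          (letI := tensorStarRing K v; ↥(heckeAlgebra k (recordHyperspecial K v l H)))) :=
  (exists_finite_forall_notMem_badSet_and_map_eq_or_isSquare K hθ hy H).elim fun Sv h =>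
    ⟨Sv, h.1, fun v hv w _ hsq => nonempty_algEquiv_polynomial_record_of_staysPrime K v w hθ hy
      ((h.2 v hv w).2.resolve_right hsq) l k hl hH hdet (h.2 v hv w).1⟩

end Record

end Summit.Ventures.HodgeRepro2.T5RecordSatakeUnramified
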